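import Summits.Ventures.KdS.RouteWSpinFlipLattice
import HarnessLib

/-!
# Venture KdS — Casals–Teixeira da Costa's Proposition 3.8 for every spin (route W + spin flip)

HONEST FRAMING (venture `Summits/Ventures/KdS`, cell `pub-kds`): consequences of the landed
route W (`RouteW.radial_vanishing_lt_one`, `RouteW.radial_vanishing_of_im_gt`, 0 cited facts) and
of the spin-flip theorem `RouteW.spinFlipTS_holds` (`RouteWSpinFlip.lean`). The conclusion of the
cited fact `CasalsTeixeiraDaCosta2022_partialModeStabilityProp38` — every generic-boundary radial
Teukolsky solution with `Im ω > 0`, `Im(λ̄ω̄) ≤ 0`, `|ω| ∉ |m|(0,Ω_SR)` (and the pair condition for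
`−2(η₁+η₀)`) vanishes — is PROVED here for every half-integer spin outside one explicit finite set
of frequencies: `prop38_of_im_gt_or_offLattice` (hypothesis `(s−1)κ₁ < Im ω ∨ OffLattice`), with the
lattice avoided off the ray `Re ω = mϖ₂` (`offLattice_of_re_ne`), above the height `(s−1)κ₂`
(`offLattice_of_im_gt_cosmo`) and always for `s ≤ 1` (`offLattice_of_le_one`); hence
`prop38_le_one` (`s ≤ 1`), `prop38_of_im_gt_cosmo`, `prop38_of_re_ne`; and, with the extreme
lattice stratum closed by the explicit partner mode of `RouteWSpinFlipLattice.lean`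
(`radial_vanishing_of_im_gt_pred_cosmo`), **`prop38_le_two`: the cited fact H3 is a theorem for
EVERY spin `s ≤ 2` — all physically relevant Teukolsky spins `|s| ≤ 2`, gravitational
perturbations `s = ±2` included — with 0 cited facts**, and `prop38_of_im_gt_pred_cosmo` for every
spin above the height `(s−2)κ₂`. What is NOT covered: for `s ≥ 5/2`, the non-extreme lattice points
`Re ω = mϖ₂`, `Im ω = jκ₂ ≤ (s−2)κ₂`, `j ∈ (s+ℤ) ∩ (0, s−2]` (polynomial kernel strata of positive
degree). No mode-stability claim beyond the displayed statements.
-/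

noncomputable section

open Set Complex

namespace Summit.Ventures.KdS

namespace RouteW

open Literature.Analysis.ODE Literature.Analysis.ODE.GeneralHeun
open Literature.Geometry.Lorentzian Literature.Geometry.Lorentzian.KerrDeSitter

/-! ### Where the lattice is avoided -/

/-- Off the cosmological threshold ray `Re ω = mϖ₂` the off-lattice condition holds
(`Im(s − 2η₂) = −(Re ω − mϖ₂)/κ₂ ≠ 0`, an integer is real). -/
theorem offLattice_of_re_ne {M a Λ : ℝ} (hsub : IsSubextremal M a Λ) (s : ℝ) {ω : ℂ} {m : ℝ}
    (hre : ω.re ≠ m * horizonAngVel a (rCosmo M a Λ)) : OffLattice M a Λ s ω m := by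
  intro j _ h
  have hκ := surfaceGravity_rCosmo_pos hsub
  have him := congrArg Complex.im h
  rw [horizonB_rCosmo_eq_neg_etaCosmo hsub] at him
  simp [etaCosmo_im] at him
  rcases him with him | him
  · exact hre (sub_eq_zero.mp him)
  · exact absurd him hκ.ne'

/-- Above the height `(s−1)κ₂` the off-lattice condition holds
(`Re(s − 2η₂) = s + Im ω/κ₂ > 2s − 1 ≥ j`). In particular it holds for every `s ≤ 1` when
`Im ω > 0`. -/
theorem offLattice_of_im_gt_cosmo {M a Λ : ℝ} (hsub : IsSubextremal M a Λ) {s : ℝ} {ω : ℂ}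
    {m : ℝ} (hhi : (s - 1) * surfaceGravity M a Λ (rCosmo M a Λ) < ω.im) : OffLattice M a Λ s ω m := by
  intro j hj h
  have hκ := surfaceGravity_rCosmo_pos hsub
  have hre := congrArg Complex.re h
  rw [horizonB_rCosmo_eq_neg_etaCosmo hsub] at hre
  simp [etaCosmo_re] at hre
  -- `hre : s + 2 * (ω.im / (2 κ₂)) = j`
  have h1 : s - 1 < ω.im / surfaceGravity M a Λ (rCosmo M a Λ) := by
    rw [lt_div_iff₀ hκ]; linarith
  have h2 : 2 * (ω.im / (2 * surfaceGravity M a Λ (rCosmo M a Λ))) =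
      ω.im / surfaceGravity M a Λ (rCosmo M a Λ) := by field_simp
  linarith

/-- For `s ≤ 1` and `Im ω > 0` the lattice is empty. -/
theorem offLattice_of_le_one {M a Λ : ℝ} (hsub : IsSubextremal M a Λ) {s : ℝ} (hs : s ≤ 1) {ω : ℂ}
    {m : ℝ} (hω : 0 < ω.im) : OffLattice M a Λ s ω m := by
  refine offLattice_of_im_gt_cosmo hsub ?_
  have hκ := surfaceGravity_rCosmo_pos hsub
  nlinarith

/-! ### Casals–Teixeira da Costa's Proposition 3.8 for every spin -/

/-- **Route W + the spin flip: CTdC Prop. 3.8's conclusion for every half-integer `s ≥ 1/2` off the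
lattice.** For subextremal `(M,a,Λ)`, `0 ≤ a`, `2s = N ≥ 1`, `Im ω > 0`, `Im(λ̄ω̄) ≤ 0`,
`|ω| ∉ |m|(0,Ω_SR)`, Prop. 3.8's pair condition for `−2(η₁+η₀)` and the off-lattice condition, every
generic-boundary radial Teukolsky solution of spin `s` vanishes on `(r₊, r_c)`: its spin-`−s` image
`R'` (same `λ̄`, `lambdaBar_lamFlip`) vanishes by `radial_vanishing_lt_one`, and the flip is injective
off the lattice. PROVED, 0 cited facts. -/
theorem radial_vanishing_offLattice {M a Λ s : ℝ} {ω : ℂ} {m : ℝ} {lam : ℂ} {R : ℝ → ℂ}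
    (hsub : IsSubextremal M a Λ) (ha : 0 ≤ a) {N : ℕ} (hN1 : 1 ≤ N) (hsN : 2 * s = N)
    (hω : 0 < ω.im) (hlam : (lambdaBar a Λ s ω m lam * (starRingEnd ℂ) ω).im ≤ 0)
    (hSR : ¬(0 < ‖ω‖ ∧ ‖ω‖ < |m| * superradiantUpper M a Λ))
    (hp₃ : PairCondition (-2 * (etaEvent M a Λ ω m + etaCauchy M a Λ ω m)))
    (hoff : OffLattice M a Λ s ω m)
    (hR : IsRadialTeukolskySolution M a Λ s ω m lam R) (hin : IsIngoingAtEventHorizon M a Λ s ω m R)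
    (hout : IsOutgoingAtCosmoHorizon M a Λ ω m R) :
    ∀ r ∈ Ioo (rPlus M a Λ) (rCosmo M a Λ), R r = 0 := by
  obtain ⟨R', hR', hin', hout', hinj⟩ := spinFlipTS_holds M a Λ s ω m lam R N hsub hN1 hsN hR hin hout
  have hN' : (1 : ℝ) ≤ N := by exact_mod_cast hN1
  have hs' : -s < 1 := by linarith
  have hlam' : (lambdaBar a Λ (-s) ω m (lamFlip a Λ s lam) * (starRingEnd ℂ) ω).im ≤ 0 := by
    rw [lambdaBar_lamFlip]; exact hlam
  exact hinj hoff (radial_vanishing_lt_one hsub ha hs' hω hlam' hSR hp₃ hR' hin' hout')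

/-- **H3 with one explicit exceptional set.** The conclusion of the cited fact
`CasalsTeixeiraDaCosta2022_partialModeStabilityProp38` (with its binders `0 ≤ a`, `2s ∈ ℤ`,
`Im ω > 0`, `Im(λ̄ω̄) ≤ 0`, `|ω| ∉ |m|(0,Ω_SR)`, pair condition `p₃`; the binders `|a| < 3/Λ`,
`m − s ∈ ℤ`, `Σm_j ∉ ℤ_{≥2}`, `p₁`, `p₂`, `p₄` are not needed) holds whenever
`(s−1)κ₁ < Im ω` (route W directly, `radial_vanishing_of_im_gt`) OR the off-lattice condition holds
(spin flip). The complement is the finite set of lattice points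
`{Re ω = mϖ₂, Im ω = jκ₂ ≤ (s−1)min(κ₁,κ₂), j ∈ (s+ℤ)∩(0,s−1]}`, empty for `s ≤ 1`. PROVED. -/
theorem prop38_of_im_gt_or_offLattice (M a Λ s : ℝ) (ω : ℂ) (m : ℝ) (lam : ℂ)
    (hsub : IsSubextremal M a Λ) (ha : 0 ≤ a) (h2s : ∃ k : ℤ, 2 * s = k) (hω : 0 < ω.im)
    (hlam : (lambdaBar a Λ s ω m lam * (starRingEnd ℂ) ω).im ≤ 0)
    (hSR : ¬(0 < ‖ω‖ ∧ ‖ω‖ < |m| * superradiantUpper M a Λ))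
    (hp₃ : PairCondition (-2 * (etaEvent M a Λ ω m + etaCauchy M a Λ ω m)))
    (hexc : (s - 1) * surfaceGravity M a Λ (rPlus M a Λ) < ω.im ∨ OffLattice M a Λ s ω m)
    (R : ℝ → ℂ) (hR : IsRadialTeukolskySolution M a Λ s ω m lam R)
    (hin : IsIngoingAtEventHorizon M a Λ s ω m R) (hout : IsOutgoingAtCosmoHorizon M a Λ ω m R) :
    ∀ r ∈ Ioo (rPlus M a Λ) (rCosmo M a Λ), R r = 0 := by
  rcases hexc with hhi | hoff
  · exact radial_vanishing_of_im_gt hsub ha hhi hω hlam hSR hp₃ hR hin hout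
  · by_cases hs : s < 1
    · exact radial_vanishing_lt_one hsub ha hs hω hlam hSR hp₃ hR hin hout
    · obtain ⟨k, hk⟩ := h2s
      have hk1 : (1 : ℤ) ≤ k := by
        have : (1 : ℝ) ≤ (k : ℝ) := by rw [← hk]; linarith
        exact_mod_cast this
      obtain ⟨N, hNk⟩ : ∃ N : ℕ, (N : ℤ) = k := ⟨k.toNat, Int.toNat_of_nonneg (by omega)⟩
      have hsN : 2 * s = (N : ℝ) := by
        rw [hk]; exact_mod_cast hNk.symm
      have hN1 : 1 ≤ N := by exact_mod_cast (hNk ▸ hk1 : (1 : ℤ) ≤ (N : ℤ))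
      exact radial_vanishing_offLattice hsub ha hN1 hsN hω hlam hSR hp₃ hoff hR hin hout

/-- Above the height `(s−1)κ₂`: H3's conclusion via the spin flip (complements
`radial_vanishing_of_im_gt`, which needs `(s−1)κ₁`; together: `Im ω > (s−1)·min(κ₁,κ₂)` suffices). -/
theorem prop38_of_im_gt_cosmo (M a Λ s : ℝ) (ω : ℂ) (m : ℝ) (lam : ℂ)
    (hsub : IsSubextremal M a Λ) (ha : 0 ≤ a) (h2s : ∃ k : ℤ, 2 * s = k) (hω : 0 < ω.im)
    (hhi : (s - 1) * surfaceGravity M a Λ (rCosmo M a Λ) < ω.im)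
    (hlam : (lambdaBar a Λ s ω m lam * (starRingEnd ℂ) ω).im ≤ 0)
    (hSR : ¬(0 < ‖ω‖ ∧ ‖ω‖ < |m| * superradiantUpper M a Λ))
    (hp₃ : PairCondition (-2 * (etaEvent M a Λ ω m + etaCauchy M a Λ ω m)))
    (R : ℝ → ℂ) (hR : IsRadialTeukolskySolution M a Λ s ω m lam R)
    (hin : IsIngoingAtEventHorizon M a Λ s ω m R) (hout : IsOutgoingAtCosmoHorizon M a Λ ω m R) :
    ∀ r ∈ Ioo (rPlus M a Λ) (rCosmo M a Λ), R r = 0 :=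
  prop38_of_im_gt_or_offLattice M a Λ s ω m lam hsub ha h2s hω hlam hSR hp₃
    (Or.inr (offLattice_of_im_gt_cosmo hsub hhi)) R hR hin hout

/-- Off the cosmological threshold ray `Re ω = mϖ₂`: H3's conclusion for every spin. -/
theorem prop38_of_re_ne (M a Λ s : ℝ) (ω : ℂ) (m : ℝ) (lam : ℂ)
    (hsub : IsSubextremal M a Λ) (ha : 0 ≤ a) (h2s : ∃ k : ℤ, 2 * s = k) (hω : 0 < ω.im)
    (hre : ω.re ≠ m * horizonAngVel a (rCosmo M a Λ))
    (hlam : (lambdaBar a Λ s ω m lam * (starRingEnd ℂ) ω).im ≤ 0)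
    (hSR : ¬(0 < ‖ω‖ ∧ ‖ω‖ < |m| * superradiantUpper M a Λ))
    (hp₃ : PairCondition (-2 * (etaEvent M a Λ ω m + etaCauchy M a Λ ω m)))
    (R : ℝ → ℂ) (hR : IsRadialTeukolskySolution M a Λ s ω m lam R)
    (hin : IsIngoingAtEventHorizon M a Λ s ω m R) (hout : IsOutgoingAtCosmoHorizon M a Λ ω m R) :
    ∀ r ∈ Ioo (rPlus M a Λ) (rCosmo M a Λ), R r = 0 :=
  prop38_of_im_gt_or_offLattice M a Λ s ω m lam hsub ha h2s hω hlam hSR hp₃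
    (Or.inr (offLattice_of_re_ne hsub s hre)) R hR hin hout

/-- **H3 for every spin `s ≤ 1` — in particular for Maxwell fields `s = 1` — is a theorem of the
tree, 0 cited facts** (for `s < 1` this is route W; at `s = 1` the lattice is empty). -/
theorem prop38_le_one (M a Λ s : ℝ) (ω : ℂ) (m : ℝ) (lam : ℂ)
    (hsub : IsSubextremal M a Λ) (ha : 0 ≤ a) (hs1 : s ≤ 1) (h2s : ∃ k : ℤ, 2 * s = k)
    (hω : 0 < ω.im) (hlam : (lambdaBar a Λ s ω m lam * (starRingEnd ℂ) ω).im ≤ 0)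
    (hSR : ¬(0 < ‖ω‖ ∧ ‖ω‖ < |m| * superradiantUpper M a Λ))
    (hp₃ : PairCondition (-2 * (etaEvent M a Λ ω m + etaCauchy M a Λ ω m)))
    (R : ℝ → ℂ) (hR : IsRadialTeukolskySolution M a Λ s ω m lam R)
    (hin : IsIngoingAtEventHorizon M a Λ s ω m R) (hout : IsOutgoingAtCosmoHorizon M a Λ ω m R) :
    ∀ r ∈ Ioo (rPlus M a Λ) (rCosmo M a Λ), R r = 0 :=
  prop38_of_im_gt_or_offLattice M a Λ s ω m lam hsub ha h2s hω hlam hSR hp₃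
    (Or.inr (offLattice_of_le_one hsub hs1 hω)) R hR hin hout


/-- Above the height `(s−2)κ₂`: H3's conclusion for every spin (spin flip off the lattice, explicit
partner at the extreme lattice point; `RouteWSpinFlipLattice`). -/
theorem prop38_of_im_gt_pred_cosmo (M a Λ s : ℝ) (ω : ℂ) (m : ℝ) (lam : ℂ)
    (hsub : IsSubextremal M a Λ) (ha : 0 ≤ a) (h2s : ∃ k : ℤ, 2 * s = k) (hω : 0 < ω.im)
    (hhi : (s - 2) * surfaceGravity M a Λ (rCosmo M a Λ) < ω.im)
    (hlam : (lambdaBar a Λ s ω m lam * (starRingEnd ℂ) ω).im ≤ 0)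
    (hSR : ¬(0 < ‖ω‖ ∧ ‖ω‖ < |m| * superradiantUpper M a Λ))
    (hp₃ : PairCondition (-2 * (etaEvent M a Λ ω m + etaCauchy M a Λ ω m)))
    (R : ℝ → ℂ) (hR : IsRadialTeukolskySolution M a Λ s ω m lam R)
    (hin : IsIngoingAtEventHorizon M a Λ s ω m R) (hout : IsOutgoingAtCosmoHorizon M a Λ ω m R) :
    ∀ r ∈ Ioo (rPlus M a Λ) (rCosmo M a Λ), R r = 0 := by
  by_cases hs : s < 1
  · exact radial_vanishing_lt_one hsub ha hs hω hlam hSR hp₃ hR hin hout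
  · obtain ⟨k, hk⟩ := h2s
    have hk1 : (1 : ℤ) ≤ k := by
      have : (1 : ℝ) ≤ (k : ℝ) := by rw [← hk]; linarith
      exact_mod_cast this
    obtain ⟨N, hNk⟩ : ∃ N : ℕ, (N : ℤ) = k := ⟨k.toNat, Int.toNat_of_nonneg (by omega)⟩
    have hsN : 2 * s = (N : ℝ) := by
      rw [hk]; exact_mod_cast hNk.symm
    have hN1 : 1 ≤ N := by exact_mod_cast (hNk ▸ hk1 : (1 : ℤ) ≤ (N : ℤ))
    exact radial_vanishing_of_im_gt_pred_cosmo hsub ha hN1 hsN hω hhi hlam hSR hp₃ hR hin hout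

/-- **H3 for every spin `s ≤ 2` — all physically relevant Teukolsky spins, `s = 2` (gravitational
perturbations of positive spin weight) included — is a theorem of the tree, 0 cited facts:** the
conclusion of `CasalsTeixeiraDaCosta2022_partialModeStabilityProp38` for subextremal `(M,a,Λ)`,
`0 ≤ a`, `2s ∈ ℤ`, `s ≤ 2`, `Im ω > 0`, `Im(λ̄ω̄) ≤ 0`, `|ω| ∉ |m|(0,Ω_SR)` and the pair condition
for `−2(η₁+η₀)`, for every generic-boundary radial Teukolsky solution. (For `s ≤ 2`,
`(s−2)κ₂ ≤ 0 < Im ω`.) PROVED. -/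
theorem prop38_le_two (M a Λ s : ℝ) (ω : ℂ) (m : ℝ) (lam : ℂ)
    (hsub : IsSubextremal M a Λ) (ha : 0 ≤ a) (hs2 : s ≤ 2) (h2s : ∃ k : ℤ, 2 * s = k)
    (hω : 0 < ω.im) (hlam : (lambdaBar a Λ s ω m lam * (starRingEnd ℂ) ω).im ≤ 0)
    (hSR : ¬(0 < ‖ω‖ ∧ ‖ω‖ < |m| * superradiantUpper M a Λ))
    (hp₃ : PairCondition (-2 * (etaEvent M a Λ ω m + etaCauchy M a Λ ω m)))
    (R : ℝ → ℂ) (hR : IsRadialTeukolskySolution M a Λ s ω m lam R)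
    (hin : IsIngoingAtEventHorizon M a Λ s ω m R) (hout : IsOutgoingAtCosmoHorizon M a Λ ω m R) :
    ∀ r ∈ Ioo (rPlus M a Λ) (rCosmo M a Λ), R r = 0 := by
  refine prop38_of_im_gt_pred_cosmo M a Λ s ω m lam hsub ha h2s hω ?_ hlam hSR hp₃ R hR hin hout
  have hκ := surfaceGravity_rCosmo_pos hsub
  nlinarith


end RouteW

end Summit.Ventures.KdS
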